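import Summits.ValiantsHypothesis.ValiantsHypothesis.Theorems.KPlusLogSqLawTropicalCensusRows
import Summits.ValiantsHypothesis.ValiantsHypothesis.Theorems.KPlusLogSqLawTridiagonalRealStatic
import Summits.ValiantsHypothesis.ValiantsHypothesis.Theorems.KPlusLogSqLawTropicalBSplitDefs

/-!
# Route «KPlusLogSqLaw», crux `WeakLifting` (stmt-ValiantsHypothesis-19561) — REAL vs TROPICAL side of the tridiagonal sector:
# THE SMALLEST TROPICALLY SILENT DESIGNS WITH REAL ZEROS — formats `(3, 2)` and `(4, 2)`

HONEST FRAMING.  Helper theorems (`--supports stmt-ValiantsHypothesis-19561 --as helper`), seat val-sym-lift-p1 (g14), cell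
`pub-symmetroid`, 2026-08-28; fourth file of the «tropical shadow» series (`…TridiagonalRealStaticPumpShadow` p596186: the `10 × 10` pump,
`14` zeros, signed count `0`; `…BoostShadow` p598473; `…BoostEightShadow` p599625).  The phenomenon «real zeros without any sign alternation of
the design's own dominant terms» is NOT exotic: it is present at the smallest sizes, where everything is Descartes-trivial, and with the sharp
factor `2` against the number of real-slope envelope breakpoints.  Two explicit designs, all dominance facts by `decide` over ALL terms
(`4! · 2⁴ = 384` at `m = 4`); nothing here is an upper bound and nothing bears on `WeakLifting` / `TropicalB` (stmt-19771) in their windows, on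
Conjecture B, on the Door-A registers, on `MatrixDescartes` (stmt-18050) or on VP ≠ VNP (FORMAT-level lifting untouched; design-level structure).

THE DESIGNS (diagonal entries `1`, class `0` = exponent `0`; links of class `1` = exponent `1`; `v = −log₂(coefficient)`).
* `(3, 2)`: links `(X, X)`, i.e. the matrix `[[1, X, 0], [X, 1, X], [0, X, 1]]`, determinant `1 − 2X²` (one positive zero `1/√2`).  Terms: the
  identity `T∅` (weight `0`) and the two links `{1}`, `{2}` (weight `2θ` EACH — identical lines).  The identity is the unique optimum for `θ ≤ −1`;
  for `θ ≥ 0` the two links tie (with the identity too at `θ = 0`): NO term is dominant.  So the ONLY dominant term ever is the identity: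
  unsigned row `DesignRowD = 0`, signed row `0`, ONE real zero.
* `(4, 2)`: links `(X, X/2, X)`, matrix `[[1, X, 0, 0], [X, 1, X/2, 0], [0, X/2, 1, X], [0, 0, X, 1]]`, determinant `1 − (9/4)X² + X⁴` (two positive
  zeros, `x² = (9 ± √17)/8`).  Terms: `T∅` (weight `0`), links `{1}`, `{3}` (weight `2θ` each), `{2}` (`2θ − 2`), the pair `{1,3}` (`4θ`, sign `+`).
  Dominant: `T∅` for `θ ≤ −1`, `{1,3}` for `θ ≥ 1`, nothing at `θ = 0` (four-way tie); both have `termSign = +1`: signed row `0`, unsigned row `1`,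
  TWO real zeros — the sharp instance `Z = 2 = 2·(#envelope pieces − 1)` of the located law candidate «Z ≤ 2·bp_ℝ» (cell bus 2026-08-28).
[this seat; folklore: continuants, IVT]
-/

-- `Summit.ValiantsHypothesis.ValiantsHypothesis.…` repeats a component by the D-0017 layout (single-conjunct summit); the name is mandated.
set_option linter.dupNamespace false
set_option autoImplicit false

namespace Summit.ValiantsHypothesis.ValiantsHypothesis.Theorems.KPlusLogSqLaw.StaticTridiagonalRealSilentSmall

open Summit.ValiantsHypothesis.ValiantsHypothesis.Theorems.MatrixDescartes.Negative
open Summit.ValiantsHypothesis.ValiantsHypothesis.Theorems.LacunarySymmetroidMatrixDescartes.TropicalCensus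
open Summit.ValiantsHypothesis.ValiantsHypothesis.Theorems.ValuativeFlip (ctK ctPath ctPath_apply ctK_add_two ctK_zero ctK_one)
open Summit.ValiantsHypothesis.ValiantsHypothesis.Theorems.KPlusLogSqLaw.StaticTridiagonalReal (det_ctPath)
open Summit.ValiantsHypothesis.ValiantsHypothesis.Theorems.SymmetroidDescartes (le_card_posRoots_of_alternating)
open Finset Polynomial
open scoped BigOperators

/-! ### The `(3, 2)` design: one real zero, no dominant term but the identity -/

/-- **`(3, 2)`: A DESIGN WHOSE ONLY DOMINANT TERM IS THE IDENTITY, WITH ONE POSITIVE ZERO.**  For the design written in the statement (classes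
`d = (0, 1)`; `ε = 1` on the class-`0` diagonal entries and the class-`1` link entries; `v ≡ 0`): `|ε| ≤ 1`; every dominant term at every integer
slope is the identity term at a slope `θ ≤ −1` (the two link terms are identical tropical lines and tie wherever they lead); hence the unsigned
row is `0` (`DesignRowD … 0`) and every sign-alternating dominant chain has length `0`; the base-2 patchwork pencil is the path matrix with unit
diagonal and links `X, X`; and its determinant `1 − 2X²` has a positive zero. [this file; `decide` over all `3!·2³` terms] -/
theorem silent_three :
    (∀ i j l, ((fun (a b : Fin 3) (l : Fin 2) => (if ((b : ℕ) = a ∧ l = 0) ∨ (((b : ℕ) = a + 1 ∨ (a : ℕ) = b + 1) ∧ l = 1) then (1 : ℤ) else 0)) i j l).natAbs ≤ 1) ∧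
    (∀ (θ : ℤ) (p : Equiv.Perm (Fin 3) × (Fin 3 → Fin 2)),
      IsDominant (![0, 1] : Fin 2 → ℕ) (fun (_ _ : Fin 3) (_ : Fin 2) => (0 : ℤ))
        (fun (a b : Fin 3) (l : Fin 2) => (if ((b : ℕ) = a ∧ l = 0) ∨ (((b : ℕ) = a + 1 ∨ (a : ℕ) = b + 1) ∧ l = 1) then (1 : ℤ) else 0)) θ p →
      θ ≤ -1 ∧ p = ((1 : Equiv.Perm (Fin 3)), fun _ : Fin 3 => (0 : Fin 2))) ∧
    DesignRowD (![0, 1] : Fin 2 → ℕ) (fun (_ _ : Fin 3) (_ : Fin 2) => (0 : ℤ))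
      (fun (a b : Fin 3) (l : Fin 2) => (if ((b : ℕ) = a ∧ l = 0) ∨ (((b : ℕ) = a + 1 ∨ (a : ℕ) = b + 1) ∧ l = 1) then (1 : ℤ) else 0)) 0 ∧
    (∀ (n : ℕ) (θ : Fin (n + 1) → ℤ) (p : Fin (n + 1) → Equiv.Perm (Fin 3) × (Fin 3 → Fin 2)),
      (∀ k, IsDominant (![0, 1] : Fin 2 → ℕ) (fun (_ _ : Fin 3) (_ : Fin 2) => (0 : ℤ))
        (fun (a b : Fin 3) (l : Fin 2) => (if ((b : ℕ) = a ∧ l = 0) ∨ (((b : ℕ) = a + 1 ∨ (a : ℕ) = b + 1) ∧ l = 1) then (1 : ℤ) else 0)) (θ k) (p k)) →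
      (∀ k : Fin n, termSign (fun (a b : Fin 3) (l : Fin 2) => (if ((b : ℕ) = a ∧ l = 0) ∨ (((b : ℕ) = a + 1 ∨ (a : ℕ) = b + 1) ∧ l = 1) then (1 : ℤ) else 0)) (p k.castSucc) *
        termSign (fun (a b : Fin 3) (l : Fin 2) => (if ((b : ℕ) = a ∧ l = 0) ∨ (((b : ℕ) = a + 1 ∨ (a : ℕ) = b + 1) ∧ l = 1) then (1 : ℤ) else 0)) (p k.succ) < 0) → n = 0) ∧
    (∑ l, (X : ℝ[X]) ^ (![0, 1] : Fin 2 → ℕ) l • (patchMatrix 2 (fun (_ _ : Fin 3) (_ : Fin 2) => (0 : ℤ))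
        (fun (a b : Fin 3) (l : Fin 2) => (if ((b : ℕ) = a ∧ l = 0) ∨ (((b : ℕ) = a + 1 ∨ (a : ℕ) = b + 1) ∧ l = 1) then (1 : ℤ) else 0)) l).map C) =
      ctPath (fun _ : ℕ => (1 : ℝ[X])) (fun _ : ℕ => (X : ℝ[X])) (fun t : ℕ => if t = 0 then (0 : ℝ[X]) else (X : ℝ[X])) 3 ∧
    1 ≤ ((ctPath (fun _ : ℕ => (1 : ℝ[X])) (fun _ : ℕ => (X : ℝ[X])) (fun t : ℕ => if t = 0 then (0 : ℝ[X]) else (X : ℝ[X])) 3).det.roots.toFinset.filter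
      (fun t => 0 < t)).card := by
  -- the three present terms
  have hpres : ∀ p : Equiv.Perm (Fin 3) × (Fin 3 → Fin 2),
      termSign (fun (a b : Fin 3) (l : Fin 2) => (if ((b : ℕ) = a ∧ l = 0) ∨ (((b : ℕ) = a + 1 ∨ (a : ℕ) = b + 1) ∧ l = 1) then (1 : ℤ) else 0)) p ≠ 0 →
      p = ((1 : Equiv.Perm (Fin 3)), fun _ : Fin 3 => (0 : Fin 2)) ∨
      p = (Equiv.swap (0 : Fin 3) 1, fun i : Fin 3 => if (i : ℕ) ≤ 1 then (1 : Fin 2) else 0) ∨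
      p = (Equiv.swap (1 : Fin 3) 2, fun i : Fin 3 => if 1 ≤ (i : ℕ) then (1 : Fin 2) else 0) := by
    decide +kernel
  have w0 : ∀ θ : ℤ, tropWeight (![0, 1] : Fin 2 → ℕ) (fun (_ _ : Fin 3) (_ : Fin 2) => (0 : ℤ)) θ ((1 : Equiv.Perm (Fin 3)), fun _ : Fin 3 => (0 : Fin 2)) = 0 := by
    intro θ
    have twa : tropWeight (![0, 1] : Fin 2 → ℕ) (fun (_ _ : Fin 3) (_ : Fin 2) => (0 : ℤ)) θ ((1 : Equiv.Perm (Fin 3)), fun _ : Fin 3 => (0 : Fin 2)) = tropWeight (![0, 1] : Fin 2 → ℕ) (fun (_ _ : Fin 3) (_ : Fin 2) => (0 : ℤ)) 0 ((1 : Equiv.Perm (Fin 3)), fun _ : Fin 3 => (0 : Fin 2)) + (θ - 0) * ∑ i, ((![0, 1] : Fin 2 → ℕ) ((((1 : Equiv.Perm (Fin 3)), fun _ : Fin 3 => (0 : Fin 2))).2 i) : ℤ) := by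
      unfold tropWeight; ring
    have e0 : tropWeight (![0, 1] : Fin 2 → ℕ) (fun (_ _ : Fin 3) (_ : Fin 2) => (0 : ℤ)) 0 ((1 : Equiv.Perm (Fin 3)), fun _ : Fin 3 => (0 : Fin 2)) = 0 := by decide +kernel
    have sl : ∑ i, ((![0, 1] : Fin 2 → ℕ) ((((1 : Equiv.Perm (Fin 3)), fun _ : Fin 3 => (0 : Fin 2))).2 i) : ℤ) = 0 := by decide +kernel
    rw [twa, e0, sl]; ring
  have w1 : ∀ θ : ℤ, tropWeight (![0, 1] : Fin 2 → ℕ) (fun (_ _ : Fin 3) (_ : Fin 2) => (0 : ℤ)) θ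
      (Equiv.swap (0 : Fin 3) 1, fun i : Fin 3 => if (i : ℕ) ≤ 1 then (1 : Fin 2) else 0) = 2 * θ := by
    intro θ
    have twa : tropWeight (![0, 1] : Fin 2 → ℕ) (fun (_ _ : Fin 3) (_ : Fin 2) => (0 : ℤ)) θ (Equiv.swap (0 : Fin 3) 1, fun i : Fin 3 => if (i : ℕ) ≤ 1 then (1 : Fin 2) else 0) = tropWeight (![0, 1] : Fin 2 → ℕ) (fun (_ _ : Fin 3) (_ : Fin 2) => (0 : ℤ)) 0 (Equiv.swap (0 : Fin 3) 1, fun i : Fin 3 => if (i : ℕ) ≤ 1 then (1 : Fin 2) else 0) + (θ - 0) * ∑ i, ((![0, 1] : Fin 2 → ℕ) (((Equiv.swap (0 : Fin 3) 1, fun i : Fin 3 => if (i : ℕ) ≤ 1 then (1 : Fin 2) else 0)).2 i) : ℤ) := by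
      unfold tropWeight; ring
    have e0 : tropWeight (![0, 1] : Fin 2 → ℕ) (fun (_ _ : Fin 3) (_ : Fin 2) => (0 : ℤ)) 0 (Equiv.swap (0 : Fin 3) 1, fun i : Fin 3 => if (i : ℕ) ≤ 1 then (1 : Fin 2) else 0) = 0 := by decide +kernel
    have sl : ∑ i, ((![0, 1] : Fin 2 → ℕ) (((Equiv.swap (0 : Fin 3) 1, fun i : Fin 3 => if (i : ℕ) ≤ 1 then (1 : Fin 2) else 0)).2 i) : ℤ) = 2 := by decide +kernel
    rw [twa, e0, sl]; ring
  have w2 : ∀ θ : ℤ, tropWeight (![0, 1] : Fin 2 → ℕ) (fun (_ _ : Fin 3) (_ : Fin 2) => (0 : ℤ)) θ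
      (Equiv.swap (1 : Fin 3) 2, fun i : Fin 3 => if 1 ≤ (i : ℕ) then (1 : Fin 2) else 0) = 2 * θ := by
    intro θ
    have twa : tropWeight (![0, 1] : Fin 2 → ℕ) (fun (_ _ : Fin 3) (_ : Fin 2) => (0 : ℤ)) θ (Equiv.swap (1 : Fin 3) 2, fun i : Fin 3 => if 1 ≤ (i : ℕ) then (1 : Fin 2) else 0) = tropWeight (![0, 1] : Fin 2 → ℕ) (fun (_ _ : Fin 3) (_ : Fin 2) => (0 : ℤ)) 0 (Equiv.swap (1 : Fin 3) 2, fun i : Fin 3 => if 1 ≤ (i : ℕ) then (1 : Fin 2) else 0) + (θ - 0) * ∑ i, ((![0, 1] : Fin 2 → ℕ) (((Equiv.swap (1 : Fin 3) 2, fun i : Fin 3 => if 1 ≤ (i : ℕ) then (1 : Fin 2) else 0)).2 i) : ℤ) := by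
      unfold tropWeight; ring
    have e0 : tropWeight (![0, 1] : Fin 2 → ℕ) (fun (_ _ : Fin 3) (_ : Fin 2) => (0 : ℤ)) 0 (Equiv.swap (1 : Fin 3) 2, fun i : Fin 3 => if 1 ≤ (i : ℕ) then (1 : Fin 2) else 0) = 0 := by decide +kernel
    have sl : ∑ i, ((![0, 1] : Fin 2 → ℕ) (((Equiv.swap (1 : Fin 3) 2, fun i : Fin 3 => if 1 ≤ (i : ℕ) then (1 : Fin 2) else 0)).2 i) : ℤ) = 2 := by decide +kernel
    rw [twa, e0, sl]; ring
  have s1 : termSign (fun (a b : Fin 3) (l : Fin 2) => (if ((b : ℕ) = a ∧ l = 0) ∨ (((b : ℕ) = a + 1 ∨ (a : ℕ) = b + 1) ∧ l = 1) then (1 : ℤ) else 0))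
      (Equiv.swap (0 : Fin 3) 1, fun i : Fin 3 => if (i : ℕ) ≤ 1 then (1 : Fin 2) else 0) ≠ 0 := by decide +kernel
  have s2 : termSign (fun (a b : Fin 3) (l : Fin 2) => (if ((b : ℕ) = a ∧ l = 0) ∨ (((b : ℕ) = a + 1 ∨ (a : ℕ) = b + 1) ∧ l = 1) then (1 : ℤ) else 0))
      (Equiv.swap (1 : Fin 3) 2, fun i : Fin 3 => if 1 ≤ (i : ℕ) then (1 : Fin 2) else 0) ≠ 0 := by decide +kernel
  have ne12 : (Equiv.swap (0 : Fin 3) 1, fun i : Fin 3 => if (i : ℕ) ≤ 1 then (1 : Fin 2) else 0) ≠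
      (Equiv.swap (1 : Fin 3) 2, fun i : Fin 3 => if 1 ≤ (i : ℕ) then (1 : Fin 2) else 0) := by decide +kernel
  have ne01 : ((1 : Equiv.Perm (Fin 3)), fun _ : Fin 3 => (0 : Fin 2)) ≠
      (Equiv.swap (0 : Fin 3) 1, fun i : Fin 3 => if (i : ℕ) ≤ 1 then (1 : Fin 2) else 0) := by decide +kernel
  -- classification of dominant terms
  have hclass : ∀ (θ : ℤ) (p : Equiv.Perm (Fin 3) × (Fin 3 → Fin 2)),
      IsDominant (![0, 1] : Fin 2 → ℕ) (fun (_ _ : Fin 3) (_ : Fin 2) => (0 : ℤ))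
        (fun (a b : Fin 3) (l : Fin 2) => (if ((b : ℕ) = a ∧ l = 0) ∨ (((b : ℕ) = a + 1 ∨ (a : ℕ) = b + 1) ∧ l = 1) then (1 : ℤ) else 0)) θ p →
      θ ≤ -1 ∧ p = ((1 : Equiv.Perm (Fin 3)), fun _ : Fin 3 => (0 : Fin 2)) := by
    intro θ p hp
    rcases hpres p hp.1 with rfl | rfl | rfl
    · refine ⟨?_, rfl⟩
      have h := hp.2 _ (Ne.symm ne01) s1
      rw [w0, w1] at h
      omega
    · exfalso
      have h := hp.2 _ (Ne.symm ne12) s2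
      rw [w1, w2] at h
      exact lt_irrefl _ h
    · exfalso
      have h := hp.2 _ ne12 s1
      rw [w1, w2] at h
      exact lt_irrefl _ h
  refine ⟨?_, hclass, ?_, ?_, ?_, ?_⟩
  · intro i j l
    dsimp only
    split_ifs <;> simp
  · -- unsigned row 0: two consecutive distinct dominant terms are impossible
    intro n θ p hθ hdom hne
    rcases Nat.eq_zero_or_pos n with h | h
    · exact h.le
    · exfalso
      apply hne ⟨0, h⟩
      rw [(hclass _ _ (hdom _)).2, (hclass _ _ (hdom _)).2]
  · -- signed chains are empty (a fortiori)
    intro n θ p hdom halt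
    rcases Nat.eq_zero_or_pos n with h | h
    · exact h
    · exfalso
      have := halt ⟨0, h⟩
      rw [(hclass _ _ (hdom _)).2, (hclass _ _ (hdom _)).2] at this
      revert this
      decide
  · -- the patchwork pencil is the path matrix with unit diagonal and links `X, X`
    refine Matrix.ext fun i j => ?_
    rw [Matrix.sum_apply, ctPath_apply]
    simp only [Matrix.smul_apply, Matrix.map_apply, patchMatrix, smul_eq_mul]
    fin_cases i <;> fin_cases j <;> simp
  · -- one positive zero of `1 − 2X²`: sign change between `1/2` and `1`
    refine le_card_posRoots_of_alternating _ 1 (![1/2, 1] : Fin 2 → ℝ) ?_ ?_ ?_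
    · refine Fin.strictMono_iff_lt_succ.2 fun j => ?_
      fin_cases j; simp; norm_num
    · intro j; fin_cases j <;> simp
    · intro j; fin_cases j
      rw [det_ctPath]
      simp [ctK_add_two, ctK_one, ctK_zero]
      norm_num

/-! ### The `(4, 2)` design: two real zeros, signed count zero, unsigned count one -/

/-- **`(4, 2)`: SIGNED TROPICAL COUNT ZERO, UNSIGNED ONE, TWO POSITIVE ZEROS.**  For the design written in the statement (classes `d = (0, 1)`;
`ε = 1` on the class-`0` diagonal entries and the class-`1` link entries; `v = 1` on the middle link (coefficient `1/2`), `0` elsewhere):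
`|ε| ≤ 1`; a term is dominant at the integer slope `θ` iff (`θ ≤ −1` and it is the identity) or (`θ ≥ 1` and it is the pair of outer links
`{1,3}`); both have `termSign = +1`, so every sign-alternating dominant chain has length `0` while the unsigned row is exactly `1`
(`DesignRowD … 1`, and the chain identity@`−1`, pair@`1` exists); the base-2 patchwork pencil is the path matrix with unit diagonal and links
`X, X/2, X`; and its determinant `1 − (9/4)X² + X⁴` has at least TWO positive zeros (sign changes at `1/2, 1, 2`).  Two real zeros against ONE
real-slope envelope breakpoint: the sharp small instance of «Z ≤ 2·bp_ℝ». [this file; `decide` over all `4!·2⁴` terms] -/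
theorem silent_four :
    (∀ i j l, ((fun (a b : Fin 4) (l : Fin 2) => (if ((b : ℕ) = a ∧ l = 0) ∨ (((b : ℕ) = a + 1 ∨ (a : ℕ) = b + 1) ∧ l = 1) then (1 : ℤ) else 0)) i j l).natAbs ≤ 1) ∧
    (∀ (θ : ℤ) (p : Equiv.Perm (Fin 4) × (Fin 4 → Fin 2)),
      IsDominant (![0, 1] : Fin 2 → ℕ)
        (fun (a b : Fin 4) (_ : Fin 2) => (if ((a : ℕ) = 1 ∧ (b : ℕ) = 2) ∨ ((a : ℕ) = 2 ∧ (b : ℕ) = 1) then (1 : ℤ) else 0))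
        (fun (a b : Fin 4) (l : Fin 2) => (if ((b : ℕ) = a ∧ l = 0) ∨ (((b : ℕ) = a + 1 ∨ (a : ℕ) = b + 1) ∧ l = 1) then (1 : ℤ) else 0)) θ p ↔
      (θ ≤ -1 ∧ p = ((1 : Equiv.Perm (Fin 4)), fun _ : Fin 4 => (0 : Fin 2))) ∨
      (1 ≤ θ ∧ p = (Equiv.swap (0 : Fin 4) 1 * Equiv.swap (2 : Fin 4) 3, fun _ : Fin 4 => (1 : Fin 2)))) ∧
    termSign (fun (a b : Fin 4) (l : Fin 2) => (if ((b : ℕ) = a ∧ l = 0) ∨ (((b : ℕ) = a + 1 ∨ (a : ℕ) = b + 1) ∧ l = 1) then (1 : ℤ) else 0))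
        ((1 : Equiv.Perm (Fin 4)), fun _ : Fin 4 => (0 : Fin 2)) = 1 ∧
    termSign (fun (a b : Fin 4) (l : Fin 2) => (if ((b : ℕ) = a ∧ l = 0) ∨ (((b : ℕ) = a + 1 ∨ (a : ℕ) = b + 1) ∧ l = 1) then (1 : ℤ) else 0))
        (Equiv.swap (0 : Fin 4) 1 * Equiv.swap (2 : Fin 4) 3, fun _ : Fin 4 => (1 : Fin 2)) = 1 ∧
    (∀ (n : ℕ) (θ : Fin (n + 1) → ℤ) (p : Fin (n + 1) → Equiv.Perm (Fin 4) × (Fin 4 → Fin 2)),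
      (∀ k, IsDominant (![0, 1] : Fin 2 → ℕ)
        (fun (a b : Fin 4) (_ : Fin 2) => (if ((a : ℕ) = 1 ∧ (b : ℕ) = 2) ∨ ((a : ℕ) = 2 ∧ (b : ℕ) = 1) then (1 : ℤ) else 0))
        (fun (a b : Fin 4) (l : Fin 2) => (if ((b : ℕ) = a ∧ l = 0) ∨ (((b : ℕ) = a + 1 ∨ (a : ℕ) = b + 1) ∧ l = 1) then (1 : ℤ) else 0)) (θ k) (p k)) →
      (∀ k : Fin n, termSign (fun (a b : Fin 4) (l : Fin 2) => (if ((b : ℕ) = a ∧ l = 0) ∨ (((b : ℕ) = a + 1 ∨ (a : ℕ) = b + 1) ∧ l = 1) then (1 : ℤ) else 0)) (p k.castSucc) *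
        termSign (fun (a b : Fin 4) (l : Fin 2) => (if ((b : ℕ) = a ∧ l = 0) ∨ (((b : ℕ) = a + 1 ∨ (a : ℕ) = b + 1) ∧ l = 1) then (1 : ℤ) else 0)) (p k.succ) < 0) → n = 0) ∧
    DesignRowD (![0, 1] : Fin 2 → ℕ)
      (fun (a b : Fin 4) (_ : Fin 2) => (if ((a : ℕ) = 1 ∧ (b : ℕ) = 2) ∨ ((a : ℕ) = 2 ∧ (b : ℕ) = 1) then (1 : ℤ) else 0))
      (fun (a b : Fin 4) (l : Fin 2) => (if ((b : ℕ) = a ∧ l = 0) ∨ (((b : ℕ) = a + 1 ∨ (a : ℕ) = b + 1) ∧ l = 1) then (1 : ℤ) else 0)) 1 ∧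
    (∑ l, (X : ℝ[X]) ^ (![0, 1] : Fin 2 → ℕ) l • (patchMatrix 2
        (fun (a b : Fin 4) (_ : Fin 2) => (if ((a : ℕ) = 1 ∧ (b : ℕ) = 2) ∨ ((a : ℕ) = 2 ∧ (b : ℕ) = 1) then (1 : ℤ) else 0))
        (fun (a b : Fin 4) (l : Fin 2) => (if ((b : ℕ) = a ∧ l = 0) ∨ (((b : ℕ) = a + 1 ∨ (a : ℕ) = b + 1) ∧ l = 1) then (1 : ℤ) else 0)) l).map C) =
      ctPath (fun _ : ℕ => (1 : ℝ[X])) (fun t : ℕ => if t = 1 then (C (1/2 : ℝ) * X : ℝ[X]) else (X : ℝ[X]))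
        (fun t : ℕ => if t = 0 then (0 : ℝ[X]) else if t = 2 then (C (1/2 : ℝ) * X : ℝ[X]) else (X : ℝ[X])) 4 ∧
    2 ≤ ((ctPath (fun _ : ℕ => (1 : ℝ[X])) (fun t : ℕ => if t = 1 then (C (1/2 : ℝ) * X : ℝ[X]) else (X : ℝ[X]))
        (fun t : ℕ => if t = 0 then (0 : ℝ[X]) else if t = 2 then (C (1/2 : ℝ) * X : ℝ[X]) else (X : ℝ[X])) 4).det.roots.toFinset.filter
      (fun t => 0 < t)).card := by
  -- names for the five present terms
  have hpres : ∀ p : Equiv.Perm (Fin 4) × (Fin 4 → Fin 2),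
      termSign (fun (a b : Fin 4) (l : Fin 2) => (if ((b : ℕ) = a ∧ l = 0) ∨ (((b : ℕ) = a + 1 ∨ (a : ℕ) = b + 1) ∧ l = 1) then (1 : ℤ) else 0)) p ≠ 0 →
      p = ((1 : Equiv.Perm (Fin 4)), fun _ : Fin 4 => (0 : Fin 2)) ∨
      p = (Equiv.swap (0 : Fin 4) 1, fun i : Fin 4 => if (i : ℕ) ≤ 1 then (1 : Fin 2) else 0) ∨
      p = (Equiv.swap (1 : Fin 4) 2, fun i : Fin 4 => if 1 ≤ (i : ℕ) ∧ (i : ℕ) ≤ 2 then (1 : Fin 2) else 0) ∨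
      p = (Equiv.swap (2 : Fin 4) 3, fun i : Fin 4 => if 2 ≤ (i : ℕ) then (1 : Fin 2) else 0) ∨
      p = (Equiv.swap (0 : Fin 4) 1 * Equiv.swap (2 : Fin 4) 3, fun _ : Fin 4 => (1 : Fin 2)) := by
    decide +kernel
  -- their weights: `0, 2θ, 2θ − 2, 2θ, 4θ`
  have w0 : ∀ θ : ℤ, tropWeight (![0, 1] : Fin 2 → ℕ)
      (fun (a b : Fin 4) (_ : Fin 2) => (if ((a : ℕ) = 1 ∧ (b : ℕ) = 2) ∨ ((a : ℕ) = 2 ∧ (b : ℕ) = 1) then (1 : ℤ) else 0)) θ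
      ((1 : Equiv.Perm (Fin 4)), fun _ : Fin 4 => (0 : Fin 2)) = 0 := by
    intro θ
    have twa : tropWeight (![0, 1] : Fin 2 → ℕ) (fun (a b : Fin 4) (_ : Fin 2) => (if ((a : ℕ) = 1 ∧ (b : ℕ) = 2) ∨ ((a : ℕ) = 2 ∧ (b : ℕ) = 1) then (1 : ℤ) else 0)) θ ((1 : Equiv.Perm (Fin 4)), fun _ : Fin 4 => (0 : Fin 2)) = tropWeight (![0, 1] : Fin 2 → ℕ) (fun (a b : Fin 4) (_ : Fin 2) => (if ((a : ℕ) = 1 ∧ (b : ℕ) = 2) ∨ ((a : ℕ) = 2 ∧ (b : ℕ) = 1) then (1 : ℤ) else 0)) 0 ((1 : Equiv.Perm (Fin 4)), fun _ : Fin 4 => (0 : Fin 2)) + (θ - 0) * ∑ i, ((![0, 1] : Fin 2 → ℕ) ((((1 : Equiv.Perm (Fin 4)), fun _ : Fin 4 => (0 : Fin 2))).2 i) : ℤ) := by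
      unfold tropWeight; ring
    have e0 : tropWeight (![0, 1] : Fin 2 → ℕ) (fun (a b : Fin 4) (_ : Fin 2) => (if ((a : ℕ) = 1 ∧ (b : ℕ) = 2) ∨ ((a : ℕ) = 2 ∧ (b : ℕ) = 1) then (1 : ℤ) else 0)) 0 ((1 : Equiv.Perm (Fin 4)), fun _ : Fin 4 => (0 : Fin 2)) = 0 := by decide +kernel
    have sl : ∑ i, ((![0, 1] : Fin 2 → ℕ) ((((1 : Equiv.Perm (Fin 4)), fun _ : Fin 4 => (0 : Fin 2))).2 i) : ℤ) = 0 := by decide +kernel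
    rw [twa, e0, sl]; ring
  have w1 : ∀ θ : ℤ, tropWeight (![0, 1] : Fin 2 → ℕ)
      (fun (a b : Fin 4) (_ : Fin 2) => (if ((a : ℕ) = 1 ∧ (b : ℕ) = 2) ∨ ((a : ℕ) = 2 ∧ (b : ℕ) = 1) then (1 : ℤ) else 0)) θ
      (Equiv.swap (0 : Fin 4) 1, fun i : Fin 4 => if (i : ℕ) ≤ 1 then (1 : Fin 2) else 0) = 2 * θ := by
    intro θ
    have twa : tropWeight (![0, 1] : Fin 2 → ℕ) (fun (a b : Fin 4) (_ : Fin 2) => (if ((a : ℕ) = 1 ∧ (b : ℕ) = 2) ∨ ((a : ℕ) = 2 ∧ (b : ℕ) = 1) then (1 : ℤ) else 0)) θ (Equiv.swap (0 : Fin 4) 1, fun i : Fin 4 => if (i : ℕ) ≤ 1 then (1 : Fin 2) else 0) = tropWeight (![0, 1] : Fin 2 → ℕ) (fun (a b : Fin 4) (_ : Fin 2) => (if ((a : ℕ) = 1 ∧ (b : ℕ) = 2) ∨ ((a : ℕ) = 2 ∧ (b : ℕ) = 1) then (1 : ℤ) else 0)) 0 (Equiv.swap (0 : Fin 4) 1,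 fun i : Fin 4 => if (i : ℕ) ≤ 1 then (1 : Fin 2) else 0) + (θ - 0) * ∑ i, ((![0, 1] : Fin 2 → ℕ) (((Equiv.swap (0 : Fin 4) 1, fun i : Fin 4 => if (i : ℕ) ≤ 1 then (1 : Fin 2) else 0)).2 i) : ℤ) := by
      unfold tropWeight; ring
    have e0 : tropWeight (![0, 1] : Fin 2 → ℕ) (fun (a b : Fin 4) (_ : Fin 2) => (if ((a : ℕ) = 1 ∧ (b : ℕ) = 2) ∨ ((a : ℕ) = 2 ∧ (b : ℕ) = 1) then (1 : ℤ) else 0)) 0 (Equiv.swap (0 : Fin 4) 1, fun i : Fin 4 => if (i : ℕ) ≤ 1 then (1 : Fin 2) else 0) = 0 := by decide +kernel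
    have sl : ∑ i, ((![0, 1] : Fin 2 → ℕ) (((Equiv.swap (0 : Fin 4) 1, fun i : Fin 4 => if (i : ℕ) ≤ 1 then (1 : Fin 2) else 0)).2 i) : ℤ) = 2 := by decide +kernel
    rw [twa, e0, sl]; ring
  have w2 : ∀ θ : ℤ, tropWeight (![0, 1] : Fin 2 → ℕ)
      (fun (a b : Fin 4) (_ : Fin 2) => (if ((a : ℕ) = 1 ∧ (b : ℕ) = 2) ∨ ((a : ℕ) = 2 ∧ (b : ℕ) = 1) then (1 : ℤ) else 0)) θ
      (Equiv.swap (1 : Fin 4) 2, fun i : Fin 4 => if 1 ≤ (i : ℕ) ∧ (i : ℕ) ≤ 2 then (1 : Fin 2) else 0) = 2 * θ - 2 := by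
    intro θ
    have twa : tropWeight (![0, 1] : Fin 2 → ℕ) (fun (a b : Fin 4) (_ : Fin 2) => (if ((a : ℕ) = 1 ∧ (b : ℕ) = 2) ∨ ((a : ℕ) = 2 ∧ (b : ℕ) = 1) then (1 : ℤ) else 0)) θ (Equiv.swap (1 : Fin 4) 2, fun i : Fin 4 => if 1 ≤ (i : ℕ) ∧ (i : ℕ) ≤ 2 then (1 : Fin 2) else 0) = tropWeight (![0, 1] : Fin 2 → ℕ) (fun (a b : Fin 4) (_ : Fin 2) => (if ((a : ℕ) = 1 ∧ (b : ℕ) = 2) ∨ ((a : ℕ) = 2 ∧ (b : ℕ) = 1) then (1 : ℤ) else 0)) 0 (Equiv.swap (1 : Fin 4) 2, fun i : Fin 4 => if 1 ≤ (i : ℕ) ∧ (i : ℕ) ≤ 2 then (1 : Fin 2) else 0) + (θ - 0) * ∑ i, ((![0, 1] : Fin 2 → ℕ) (((Equiv.swap (1 : Fin 4) 2, fun i : Fin 4 => if 1 ≤ (i : ℕ) ∧ (i : ℕ) ≤ 2 then (1 : Fin 2) else 0)).2 i) : ℤ) := by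
      unfold tropWeight; ring
    have e0 : tropWeight (![0, 1] : Fin 2 → ℕ) (fun (a b : Fin 4) (_ : Fin 2) => (if ((a : ℕ) = 1 ∧ (b : ℕ) = 2) ∨ ((a : ℕ) = 2 ∧ (b : ℕ) = 1) then (1 : ℤ) else 0)) 0 (Equiv.swap (1 : Fin 4) 2, fun i : Fin 4 => if 1 ≤ (i : ℕ) ∧ (i : ℕ) ≤ 2 then (1 : Fin 2) else 0) = -2 := by decide +kernel
    have sl : ∑ i, ((![0, 1] : Fin 2 → ℕ) (((Equiv.swap (1 : Fin 4) 2, fun i : Fin 4 => if 1 ≤ (i : ℕ) ∧ (i : ℕ) ≤ 2 then (1 : Fin 2) else 0)).2 i) : ℤ) = 2 := by decide +kernel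
    rw [twa, e0, sl]; ring
  have w3 : ∀ θ : ℤ, tropWeight (![0, 1] : Fin 2 → ℕ)
      (fun (a b : Fin 4) (_ : Fin 2) => (if ((a : ℕ) = 1 ∧ (b : ℕ) = 2) ∨ ((a : ℕ) = 2 ∧ (b : ℕ) = 1) then (1 : ℤ) else 0)) θ
      (Equiv.swap (2 : Fin 4) 3, fun i : Fin 4 => if 2 ≤ (i : ℕ) then (1 : Fin 2) else 0) = 2 * θ := by
    intro θ
    have twa : tropWeight (![0, 1] : Fin 2 → ℕ) (fun (a b : Fin 4) (_ : Fin 2) => (if ((a : ℕ) = 1 ∧ (b : ℕ) = 2) ∨ ((a : ℕ) = 2 ∧ (b : ℕ) = 1) then (1 : ℤ) else 0)) θ (Equiv.swap (2 : Fin 4) 3, fun i : Fin 4 => if 2 ≤ (i : ℕ) then (1 : Fin 2) else 0) = tropWeight (![0, 1] : Fin 2 → ℕ) (fun (a b : Fin 4) (_ : Fin 2) => (if ((a : ℕ) = 1 ∧ (b : ℕ) = 2) ∨ ((a : ℕ) = 2 ∧ (b : ℕ) = 1) then (1 : ℤ) else 0)) 0 (Equiv.swap (2 : Fin 4) 3,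 fun i : Fin 4 => if 2 ≤ (i : ℕ) then (1 : Fin 2) else 0) + (θ - 0) * ∑ i, ((![0, 1] : Fin 2 → ℕ) (((Equiv.swap (2 : Fin 4) 3, fun i : Fin 4 => if 2 ≤ (i : ℕ) then (1 : Fin 2) else 0)).2 i) : ℤ) := by
      unfold tropWeight; ring
    have e0 : tropWeight (![0, 1] : Fin 2 → ℕ) (fun (a b : Fin 4) (_ : Fin 2) => (if ((a : ℕ) = 1 ∧ (b : ℕ) = 2) ∨ ((a : ℕ) = 2 ∧ (b : ℕ) = 1) then (1 : ℤ) else 0)) 0 (Equiv.swap (2 : Fin 4) 3, fun i : Fin 4 => if 2 ≤ (i : ℕ) then (1 : Fin 2) else 0) = 0 := by decide +kernel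
    have sl : ∑ i, ((![0, 1] : Fin 2 → ℕ) (((Equiv.swap (2 : Fin 4) 3, fun i : Fin 4 => if 2 ≤ (i : ℕ) then (1 : Fin 2) else 0)).2 i) : ℤ) = 2 := by decide +kernel
    rw [twa, e0, sl]; ring
  have w13 : ∀ θ : ℤ, tropWeight (![0, 1] : Fin 2 → ℕ)
      (fun (a b : Fin 4) (_ : Fin 2) => (if ((a : ℕ) = 1 ∧ (b : ℕ) = 2) ∨ ((a : ℕ) = 2 ∧ (b : ℕ) = 1) then (1 : ℤ) else 0)) θ
      (Equiv.swap (0 : Fin 4) 1 * Equiv.swap (2 : Fin 4) 3, fun _ : Fin 4 => (1 : Fin 2)) = 4 * θ := by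
    intro θ
    have twa : tropWeight (![0, 1] : Fin 2 → ℕ) (fun (a b : Fin 4) (_ : Fin 2) => (if ((a : ℕ) = 1 ∧ (b : ℕ) = 2) ∨ ((a : ℕ) = 2 ∧ (b : ℕ) = 1) then (1 : ℤ) else 0)) θ (Equiv.swap (0 : Fin 4) 1 * Equiv.swap (2 : Fin 4) 3, fun _ : Fin 4 => (1 : Fin 2)) = tropWeight (![0, 1] : Fin 2 → ℕ) (fun (a b : Fin 4) (_ : Fin 2) => (if ((a : ℕ) = 1 ∧ (b : ℕ) = 2) ∨ ((a : ℕ) = 2 ∧ (b : ℕ) = 1) then (1 : ℤ) else 0)) 0 (Equiv.swap (0 : Fin 4) 1 * Equiv.swap (2 : Fin 4) 3, fun _ : Fin 4 => (1 : Fin 2)) + (θ - 0) * ∑ i, ((![0, 1] : Fin 2 → ℕ) (((Equiv.swap (0 : Fin 4) 1 * Equiv.swap (2 : Fin 4) 3, fun _ : Fin 4 => (1 : Fin 2))).2 i) : ℤ) := by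
      unfold tropWeight; ring
    have e0 : tropWeight (![0, 1] : Fin 2 → ℕ) (fun (a b : Fin 4) (_ : Fin 2) => (if ((a : ℕ) = 1 ∧ (b : ℕ) = 2) ∨ ((a : ℕ) = 2 ∧ (b : ℕ) = 1) then (1 : ℤ) else 0)) 0 (Equiv.swap (0 : Fin 4) 1 * Equiv.swap (2 : Fin 4) 3, fun _ : Fin 4 => (1 : Fin 2)) = 0 := by decide +kernel
    have sl : ∑ i, ((![0, 1] : Fin 2 → ℕ) (((Equiv.swap (0 : Fin 4) 1 * Equiv.swap (2 : Fin 4) 3, fun _ : Fin 4 => (1 : Fin 2))).2 i) : ℤ) = 4 := by decide +kernel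
    rw [twa, e0, sl]; ring
  -- presence of the five terms and pairwise distinctness (by `decide`)
  have pres : termSign (fun (a b : Fin 4) (l : Fin 2) => (if ((b : ℕ) = a ∧ l = 0) ∨ (((b : ℕ) = a + 1 ∨ (a : ℕ) = b + 1) ∧ l = 1) then (1 : ℤ) else 0))
        ((1 : Equiv.Perm (Fin 4)), fun _ : Fin 4 => (0 : Fin 2)) ≠ 0 ∧
      termSign (fun (a b : Fin 4) (l : Fin 2) => (if ((b : ℕ) = a ∧ l = 0) ∨ (((b : ℕ) = a + 1 ∨ (a : ℕ) = b + 1) ∧ l = 1) then (1 : ℤ) else 0))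
        (Equiv.swap (0 : Fin 4) 1, fun i : Fin 4 => if (i : ℕ) ≤ 1 then (1 : Fin 2) else 0) ≠ 0 ∧
      termSign (fun (a b : Fin 4) (l : Fin 2) => (if ((b : ℕ) = a ∧ l = 0) ∨ (((b : ℕ) = a + 1 ∨ (a : ℕ) = b + 1) ∧ l = 1) then (1 : ℤ) else 0))
        (Equiv.swap (1 : Fin 4) 2, fun i : Fin 4 => if 1 ≤ (i : ℕ) ∧ (i : ℕ) ≤ 2 then (1 : Fin 2) else 0) ≠ 0 ∧
      termSign (fun (a b : Fin 4) (l : Fin 2) => (if ((b : ℕ) = a ∧ l = 0) ∨ (((b : ℕ) = a + 1 ∨ (a : ℕ) = b + 1) ∧ l = 1) then (1 : ℤ) else 0))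
        (Equiv.swap (2 : Fin 4) 3, fun i : Fin 4 => if 2 ≤ (i : ℕ) then (1 : Fin 2) else 0) ≠ 0 ∧
      termSign (fun (a b : Fin 4) (l : Fin 2) => (if ((b : ℕ) = a ∧ l = 0) ∨ (((b : ℕ) = a + 1 ∨ (a : ℕ) = b + 1) ∧ l = 1) then (1 : ℤ) else 0))
        (Equiv.swap (0 : Fin 4) 1 * Equiv.swap (2 : Fin 4) 3, fun _ : Fin 4 => (1 : Fin 2)) ≠ 0 := by
    refine ⟨by decide +kernel, by decide +kernel, by decide +kernel, by decide +kernel, by decide +kernel⟩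
  obtain ⟨pr0, pr1, pr2, pr3, pr13⟩ := pres
  have d01 : ((1 : Equiv.Perm (Fin 4)), fun _ : Fin 4 => (0 : Fin 2)) ≠ (Equiv.swap (0 : Fin 4) 1, fun i : Fin 4 => if (i : ℕ) ≤ 1 then (1 : Fin 2) else 0) := by decide +kernel
  have d013 : ((1 : Equiv.Perm (Fin 4)), fun _ : Fin 4 => (0 : Fin 2)) ≠ (Equiv.swap (0 : Fin 4) 1 * Equiv.swap (2 : Fin 4) 3, fun _ : Fin 4 => (1 : Fin 2)) := by decide +kernel
  have d13 : (Equiv.swap (0 : Fin 4) 1, fun i : Fin 4 => if (i : ℕ) ≤ 1 then (1 : Fin 2) else 0) ≠ (Equiv.swap (2 : Fin 4) 3, fun i : Fin 4 => if 2 ≤ (i : ℕ) then (1 : Fin 2) else 0) := by decide +kernel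
  have d12 : (Equiv.swap (0 : Fin 4) 1, fun i : Fin 4 => if (i : ℕ) ≤ 1 then (1 : Fin 2) else 0) ≠ (Equiv.swap (1 : Fin 4) 2, fun i : Fin 4 => if 1 ≤ (i : ℕ) ∧ (i : ℕ) ≤ 2 then (1 : Fin 2) else 0) := by decide +kernel
  have d1_13 : (Equiv.swap (0 : Fin 4) 1, fun i : Fin 4 => if (i : ℕ) ≤ 1 then (1 : Fin 2) else 0) ≠ (Equiv.swap (0 : Fin 4) 1 * Equiv.swap (2 : Fin 4) 3, fun _ : Fin 4 => (1 : Fin 2)) := by decide +kernel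
  -- classification
  have hclass : ∀ (θ : ℤ) (p : Equiv.Perm (Fin 4) × (Fin 4 → Fin 2)),
      IsDominant (![0, 1] : Fin 2 → ℕ)
        (fun (a b : Fin 4) (_ : Fin 2) => (if ((a : ℕ) = 1 ∧ (b : ℕ) = 2) ∨ ((a : ℕ) = 2 ∧ (b : ℕ) = 1) then (1 : ℤ) else 0))
        (fun (a b : Fin 4) (l : Fin 2) => (if ((b : ℕ) = a ∧ l = 0) ∨ (((b : ℕ) = a + 1 ∨ (a : ℕ) = b + 1) ∧ l = 1) then (1 : ℤ) else 0)) θ p ↔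
      (θ ≤ -1 ∧ p = ((1 : Equiv.Perm (Fin 4)), fun _ : Fin 4 => (0 : Fin 2))) ∨
      (1 ≤ θ ∧ p = (Equiv.swap (0 : Fin 4) 1 * Equiv.swap (2 : Fin 4) 3, fun _ : Fin 4 => (1 : Fin 2))) := by
    intro θ p
    constructor
    · intro hp
      rcases hpres p hp.1 with rfl | rfl | rfl | rfl | rfl
      · refine Or.inl ⟨?_, rfl⟩
        have h := hp.2 _ (Ne.symm d013) pr13
        rw [w0, w13] at h
        omega
      · exfalso
        have h := hp.2 _ (Ne.symm d13) pr3
        rw [w1, w3] at h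
        exact lt_irrefl _ h
      · exfalso
        have h := hp.2 _ d12 pr1
        rw [w1, w2] at h
        omega
      · exfalso
        have h := hp.2 _ d13 pr1
        rw [w1, w3] at h
        exact lt_irrefl _ h
      · refine Or.inr ⟨?_, rfl⟩
        have h := hp.2 _ d1_13 pr1
        rw [w1, w13] at h
        omega
    · rintro (⟨h, rfl⟩ | ⟨h, rfl⟩)
      · refine ⟨pr0, fun q hq hq' => ?_⟩
        rcases hpres q hq' with rfl | rfl | rfl | rfl | rfl
        · exact absurd rfl hq
        · rw [w0, w1]; omega
        · rw [w0, w2]; omega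
        · rw [w0, w3]; omega
        · rw [w0, w13]; omega
      · refine ⟨pr13, fun q hq hq' => ?_⟩
        rcases hpres q hq' with rfl | rfl | rfl | rfl | rfl
        · rw [w13, w0]; omega
        · rw [w13, w1]; omega
        · rw [w13, w2]; omega
        · rw [w13, w3]; omega
        · exact absurd rfl hq
  have sg0 : termSign (fun (a b : Fin 4) (l : Fin 2) => (if ((b : ℕ) = a ∧ l = 0) ∨ (((b : ℕ) = a + 1 ∨ (a : ℕ) = b + 1) ∧ l = 1) then (1 : ℤ) else 0))
        ((1 : Equiv.Perm (Fin 4)), fun _ : Fin 4 => (0 : Fin 2)) = 1 := by decide +kernel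
  have sg13 : termSign (fun (a b : Fin 4) (l : Fin 2) => (if ((b : ℕ) = a ∧ l = 0) ∨ (((b : ℕ) = a + 1 ∨ (a : ℕ) = b + 1) ∧ l = 1) then (1 : ℤ) else 0))
        (Equiv.swap (0 : Fin 4) 1 * Equiv.swap (2 : Fin 4) 3, fun _ : Fin 4 => (1 : Fin 2)) = 1 := by decide +kernel
  have hsign : ∀ (θ : ℤ) (p : Equiv.Perm (Fin 4) × (Fin 4 → Fin 2)),
      IsDominant (![0, 1] : Fin 2 → ℕ)
        (fun (a b : Fin 4) (_ : Fin 2) => (if ((a : ℕ) = 1 ∧ (b : ℕ) = 2) ∨ ((a : ℕ) = 2 ∧ (b : ℕ) = 1) then (1 : ℤ) else 0))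
        (fun (a b : Fin 4) (l : Fin 2) => (if ((b : ℕ) = a ∧ l = 0) ∨ (((b : ℕ) = a + 1 ∨ (a : ℕ) = b + 1) ∧ l = 1) then (1 : ℤ) else 0)) θ p →
      termSign (fun (a b : Fin 4) (l : Fin 2) => (if ((b : ℕ) = a ∧ l = 0) ∨ (((b : ℕ) = a + 1 ∨ (a : ℕ) = b + 1) ∧ l = 1) then (1 : ℤ) else 0)) p = 1 := by
    intro θ p hp
    rcases (hclass θ p).1 hp with ⟨-, rfl⟩ | ⟨-, rfl⟩
    · exact sg0
    · exact sg13
  refine ⟨?_, hclass, sg0, sg13, ?_, ?_, ?_, ?_⟩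
  · intro i j l
    dsimp only
    split_ifs <;> simp
  · -- signed chains are empty
    intro n θ p hdom halt
    rcases Nat.eq_zero_or_pos n with h | h
    · exact h
    · exfalso
      have := halt ⟨0, h⟩
      rw [hsign _ _ (hdom _), hsign _ _ (hdom _)] at this
      revert this
      decide
  · -- unsigned row 1
    intro n θ p hθ hdom hne
    by_contra hn
    have hn2 : 2 ≤ n := by omega
    have h01 : p ⟨0, by omega⟩ ≠ p ⟨1, by omega⟩ := hne ⟨0, by omega⟩
    have h12 : p ⟨1, by omega⟩ ≠ p ⟨2, by omega⟩ := hne ⟨1, by omega⟩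
    have t01 : θ ⟨0, by omega⟩ < θ ⟨1, by omega⟩ := hθ (Fin.mk_lt_mk.mpr (by norm_num))
    have t12 : θ ⟨1, by omega⟩ < θ ⟨2, by omega⟩ := hθ (Fin.mk_lt_mk.mpr (by norm_num))
    rcases (hclass _ _).1 (hdom ⟨1, by omega⟩) with ⟨h1, e1⟩ | ⟨h1, e1⟩
    · rcases (hclass _ _).1 (hdom ⟨0, by omega⟩) with ⟨h0, e0⟩ | ⟨h0, e0⟩
      · exact h01 (e0.trans e1.symm)
      · omega
    · rcases (hclass _ _).1 (hdom ⟨2, by omega⟩) with ⟨h2, e2⟩ | ⟨h2, e2⟩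
      · omega
      · exact h12 (e1.trans e2.symm)
  · -- the patchwork pencil is the path matrix with unit diagonal and links `X, X/2, X`
    refine Matrix.ext fun i j => ?_
    rw [Matrix.sum_apply, ctPath_apply]
    simp only [Matrix.smul_apply, Matrix.map_apply, patchMatrix, smul_eq_mul]
    fin_cases i <;> fin_cases j <;> simp [Fin.sum_univ_two]
  · -- two positive zeros of `1 − (9/4)X² + X⁴`: sign changes at `1/2, 1, 2`
    refine le_card_posRoots_of_alternating _ 2 (![1/2, 1, 2] : Fin 3 → ℝ) ?_ ?_ ?_
    · refine Fin.strictMono_iff_lt_succ.2 fun j => ?_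
      fin_cases j
      · simp only [Fin.castSucc_mk, Fin.succ_mk]; norm_num
      · simp
    · intro j; fin_cases j <;> simp
    · intro j; fin_cases j <;>
        (rw [det_ctPath]; simp [ctK_add_two, ctK_one, ctK_zero]; norm_num)

end Summit.ValiantsHypothesis.ValiantsHypothesis.Theorems.KPlusLogSqLaw.StaticTridiagonalRealSilentSmall
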